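import Summits.Ventures.PercRepro.ProfilePointedCircuitClassesInOutSeries

/-!
# PercRepro — THE IN–OUT INEQUALITY AT `n = 10`, I: THE DEFICIENCY `κ(W) ≤ 3` AND THE SERIES CLASS OF A DEFICIENT
DEMAND (p5, gen 40; `proofs/P5-GM1.md` §59)

`N` is a matroid with `#E = 10`, `ρ(E) = 6` (nullity `4`), `e ∈ E` is not a coloop and `E − e` has no coloops (so
`N` has no coloops).  The DEMANDS are the bi-independent `4`-sets `W ∋ e`, the UNITS the bi-independent `5`-sets
`W' ∌ e`, and a unit `W'` is a NEIGHBOUR of the demand `W` when `W ∩ W' = ∅` — then `W' = B − z` for the basis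
`B := E ∖ W` and a point `z ∈ B` with `ρ(W + z) = 5`.  The demand `W` therefore has `6 − κ(W)` neighbours, where
`κ(W) := #{z ∈ B : ρ(W + z) = 4}`; `κ(W) ≤ 3` (four such points would span `cl W`, and the two remaining points of `B`
would be coloops), and when `κ(W) = 3` the basis splits as `B = K ⊔ P` with `P = {z ∈ B : ρ(W + z) = 5}` a
3-point SERIES CLASS (`ρ(E − {p, p'}) = 5` for every pair in `P`), `ρ(W + p + p') = 6`, and some `w ∈ W − e` has
`B − p + w` a basis for every `p ∈ P` (`p` is not a coloop of `N ∖ e`; the symmetry lemma `rk_insert_erase_eq_of_series`).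
For such a `w` the three `5`-sets `W' := (B − {p, p'}) + w` are units with `W ∩ W' = {w}`, `(E ∖ W') ∖ W = {p, p'}`
and `ρ(E − {p, p'}) = 5` — the resources paid to the deficient demands in part II.

THIS FILE (part I): the helpers `rk_insert_le_add_one`, `subset_clF_of_rk_le_rk`, `rk_le_rk_of_subset_clF`;
`card_filter_rk_insert_eq_four_le_three` (`κ(W) ≤ 3`); `card_filter_rk_insert_eq_five_le_card_disjoint_units`
(`6 − κ(W)` injects into the neighbours); `rk_sdiff_pair_eq_five_of_deficient` (the series-class property) and
`rk_insert_insert_eq_six_of_deficient`.  Part II (`…InOutTenB`): the symmetry lemma, the point `w` and the three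
resource units `unit_of_deficient`; part III (`…InOutTenC`): the double counting and the theorem.
-/

open scoped Matroid

namespace PercRepro.Cogirth

open Finset ThmH Skew Shadow Profile

variable {α : Type} [DecidableEq α] {N : Matroid α} [N.Finite]

section InOutTenA

/-! ### Rank helpers -/

/-- `ρ(X + z) ≤ ρ(X) + 1`. -/
theorem rk_insert_le_add_one {z : α} (hz : z ∈ gr N) {X : Finset α} (hX : X ⊆ gr N) :
    rk N (insert z X) ≤ rk N X + 1 := by
  rw [rk_insert_eq hz hX]
  split_ifs <;> omega

/-- A superset of no larger rank lies in the closure: `X ⊆ Z ⊆ E`, `ρ(Z) ≤ ρ(X)` ⟹ `Z ⊆ cl X`. -/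
theorem subset_clF_of_rk_le_rk {X Z : Finset α} (hXZ : X ⊆ Z) (hZ : Z ⊆ gr N) (h : rk N Z ≤ rk N X) :
    Z ⊆ clF N X := by
  intro z hz
  rw [mem_clF_iff_rk_insert_eq (hZ hz) (hXZ.trans hZ)]
  have h1 := rk_mono' (M := N) (insert_subset hz hXZ)
  have h2 := rk_mono' (M := N) (subset_insert z X)
  omega

omit [DecidableEq α] in
/-- `Z ⊆ cl X` ⟹ `ρ(Z) ≤ ρ(X)`. -/
theorem rk_le_rk_of_subset_clF {X Z : Finset α} (h : Z ⊆ clF N X) : rk N Z ≤ rk N X :=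
  (rk_mono' (M := N) h).trans (rk_clF_eq_rk X).le

/-! ### The deficiency `κ(W)` -/

variable {e : α}

/-- **`κ(W) ≤ 3`**: for a bi-independent `4`-set `W` of a coloop-free matroid with `#E = 10`, `ρ(E) = 6`, at most
three points `z` of the basis `E ∖ W` have `ρ(W + z) = 4`.  Four such points `A` lie in `cl W`, so `ρ(W ∪ A) = 4`,
and the two remaining points `x, y` of `E ∖ W` give `ρ(E − x) ≤ ρ(W ∪ A) + 1 = 5`. -/
theorem card_filter_rk_insert_eq_four_le_three (hn : (gr N).card = 10)
    (hcf : ∀ x ∈ gr N, rk N ((gr N).erase x) = 6) {W : Finset α} (hW : W ∈ biIndepSets N 4) :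
    ((gr N \ W).filter (fun z => rk N (insert z W) = 4)).card ≤ 3 := by
  rw [mem_biIndepSets] at hW
  obtain ⟨hWg, hW4, hWrk, hWc⟩ := hW
  rw [hW4] at hWrk
  by_contra hcon
  have h4 : 4 ≤ ((gr N \ W).filter (fun z => rk N (insert z W) = 4)).card := by omega
  obtain ⟨A, hAsub, hA4⟩ := exists_subset_card_eq h4
  have hAB : A ⊆ gr N \ W := hAsub.trans (filter_subset _ _)
  have hAg : A ⊆ gr N := hAB.trans sdiff_subset
  have hAcl : A ⊆ clF N W := by
    intro a ha
    have ha' := (mem_filter.1 (hAsub ha)).2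
    rw [mem_clF_iff_rk_insert_eq (hAg ha) hWg, ha', hWrk]
  -- `ρ(W ∪ A) = 4`
  have hWA : rk N (W ∪ A) ≤ 4 := by
    have h1 : W ∪ A ⊆ clF N W :=
      union_subset (fun w hw => mem_clF_of_mem_of_subset_gr hWg hw) hAcl
    have h2 := rk_le_rk_of_subset_clF h1
    omega
  -- the two remaining points of `E ∖ W`
  have hBcard : (gr N \ W).card = 6 := by rw [card_sdiff_of_subset hWg, hn, hW4]
  have hBA : ((gr N \ W) \ A).card = 2 := by rw [card_sdiff_of_subset hAB, hBcard, hA4]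
  obtain ⟨x, y, hxy, hBAxy⟩ := card_eq_two.1 hBA
  have hxBA : x ∈ (gr N \ W) \ A := by rw [hBAxy]; exact mem_insert_self x {y}
  have hyBA : y ∈ (gr N \ W) \ A := by rw [hBAxy]; exact mem_insert_of_mem (mem_singleton_self y)
  have hxg : x ∈ gr N := (mem_sdiff.1 (mem_sdiff.1 hxBA).1).1
  have hyg : y ∈ gr N := (mem_sdiff.1 (mem_sdiff.1 hyBA).1).1
  -- `E − x ⊆ (W ∪ A) + y`
  have hsub : (gr N).erase x ⊆ insert y (W ∪ A) := by
    intro g hg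
    rw [mem_erase] at hg
    rw [mem_insert, mem_union]
    by_cases hgW : g ∈ W
    · exact Or.inr (Or.inl hgW)
    by_cases hgA : g ∈ A
    · exact Or.inr (Or.inr hgA)
    have hgBA : g ∈ (gr N \ W) \ A := mem_sdiff.2 ⟨mem_sdiff.2 ⟨hg.2, hgW⟩, hgA⟩
    rw [hBAxy, mem_insert, mem_singleton] at hgBA
    rcases hgBA with h | h
    · exact absurd h hg.1
    · exact Or.inl h
  have h1 := rk_mono' (M := N) hsub
  have h2 := rk_insert_le_add_one hyg (union_subset hWg hAg)
  have h3 := hcf x hxg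
  omega

/-- The points `z ∈ E ∖ W` with `ρ(W + z) = 5` inject into the units disjoint from `W` (`z ↦ (E ∖ W) − z`). -/
theorem card_filter_rk_insert_eq_five_le_card_disjoint_units (hn : (gr N).card = 10) {W : Finset α}
    (hW : W ∈ biIndepSets N 4) (heW : e ∈ W) :
    ((gr N \ W).filter (fun z => rk N (insert z W) = 5)).card ≤
      (((biIndepSets N 5).filter (fun W' => e ∉ W')).filter (fun W' => W ∩ W' = ∅)).card := by
  rw [mem_biIndepSets] at hW
  obtain ⟨hWg, hW4, hWrk, hWc⟩ := hW
  have hBcard : (gr N \ W).card = 6 := by rw [card_sdiff_of_subset hWg, hn, hW4]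
  apply card_le_card_of_injOn (fun z => (gr N \ W).erase z)
  · intro z hz
    rw [mem_coe, mem_filter, mem_sdiff] at hz
    obtain ⟨⟨hzg, hzW⟩, hz5⟩ := hz
    rw [mem_coe, mem_filter, mem_filter, mem_biIndepSets]
    have hzB : z ∈ gr N \ W := mem_sdiff.2 ⟨hzg, hzW⟩
    have hcompl : gr N \ (gr N \ W).erase z = insert z W := by
      ext g
      rw [mem_sdiff, mem_erase, mem_sdiff, mem_insert]
      constructor
      · rintro ⟨hg, h⟩
        by_cases hgW : g ∈ W
        · exact Or.inr hgW
        · by_cases hgz : g = z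
          · exact Or.inl hgz
          · exact absurd ⟨hgz, hg, hgW⟩ h
      · rintro (h | h)
        · subst h
          exact ⟨hzg, fun h => h.1 rfl⟩
        · exact ⟨hWg h, fun h' => h'.2.2 h⟩
    refine ⟨⟨⟨(erase_subset _ _).trans sdiff_subset, ?_, ?_, ?_⟩, ?_⟩, ?_⟩
    · rw [card_erase_of_mem hzB, hBcard]
    · rw [card_erase_of_mem hzB, hBcard]
      have := rk_eq_card_of_subset_of_rk_eq_card (M := N) (erase_subset z (gr N \ W)) hWc
      rw [card_erase_of_mem hzB, hBcard] at this
      exact this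
    · rw [hcompl, hz5, card_insert_of_notMem hzW, hW4]
    · intro he
      exact (mem_sdiff.1 (mem_of_mem_erase he)).2 heW
    · ext g
      simp only [mem_inter, mem_erase, mem_sdiff, notMem_empty, iff_false]
      tauto
  · intro z hz z' hz' h
    rw [mem_coe, mem_filter, mem_sdiff] at hz hz'
    simp only at h
    have h1 : z ∈ insert z ((gr N \ W).erase z) := mem_insert_self _ _
    rw [insert_erase (mem_sdiff.2 hz.1), ← insert_erase (mem_sdiff.2 hz'.1), ← h, mem_insert] at h1
    rcases h1 with h1 | h1
    · exact h1
    · exact absurd (mem_erase.1 h1).1 (fun h => h rfl)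

/-! ### The structure of a deficient demand (`κ(W) = 3`) -/

/-- In a deficient demand, `P := {z ∈ E ∖ W : ρ(W + z) = 5}` is a series class: `ρ(E − {p, p'}) = 5` for
`p ≠ p'` in `P`.  Indeed `E ∖ P = W ∪ K ⊆ cl W` has rank `4`, so `ρ(E − {p, p'}) ≤ 4 + #(P − {p, p'}) = 5`, while
`ρ(E − {p, p'}) ≥ ρ(E − p) − 1 = 5`. -/
theorem rk_sdiff_pair_eq_five_of_deficient
    (hcf : ∀ x ∈ gr N, rk N ((gr N).erase x) = 6) {W : Finset α} (hW : W ∈ biIndepSets N 4)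
    (hP : ((gr N \ W).filter (fun z => rk N (insert z W) = 5)).card = 3) {p p' : α}
    (hp : p ∈ (gr N \ W).filter (fun z => rk N (insert z W) = 5))
    (hp' : p' ∈ (gr N \ W).filter (fun z => rk N (insert z W) = 5)) (hpp' : p ≠ p') :
    rk N (gr N \ {p, p'}) = 5 := by
  rw [mem_biIndepSets] at hW
  obtain ⟨hWg, hW4, hWrk, hWc⟩ := hW
  rw [hW4] at hWrk
  set P := (gr N \ W).filter (fun z => rk N (insert z W) = 5) with hPdef
  have hPB : P ⊆ gr N \ W := filter_subset _ _
  have hPg : P ⊆ gr N := hPB.trans sdiff_subset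
  have hpg : p ∈ gr N := hPg hp
  have hp'g : p' ∈ gr N := hPg hp'
  -- `E ∖ P ⊆ cl W`
  have hEP : gr N \ P ⊆ clF N W := by
    intro g hg
    rw [mem_sdiff] at hg
    by_cases hgW : g ∈ W
    · exact mem_clF_of_mem_of_subset_gr hWg hgW
    · have hgB : g ∈ gr N \ W := mem_sdiff.2 ⟨hg.1, hgW⟩
      have h5 : rk N (insert g W) ≠ 5 := fun h => hg.2 (mem_filter.2 ⟨hgB, h⟩)
      have h1 := rk_insert_le_add_one hg.1 hWg
      have h2 := rk_mono' (M := N) (subset_insert g W)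
      rw [mem_clF_iff_rk_insert_eq hg.1 hWg]
      omega
  have hrkEP : rk N (gr N \ P) ≤ 4 := by
    have := rk_le_rk_of_subset_clF hEP
    omega
  -- `E − {p, p'} = (E ∖ P) ∪ (P ∖ {p, p'})`
  have hpair : ({p, p'} : Finset α) ⊆ P := by
    intro g hg
    rw [mem_insert, mem_singleton] at hg
    rcases hg with h | h <;> subst h <;> assumption
  have hsplit : gr N \ {p, p'} = (gr N \ P) ∪ (P \ {p, p'}) := by
    ext g
    rw [mem_sdiff, mem_union, mem_sdiff, mem_sdiff]
    constructor
    · rintro ⟨hg, hgpp⟩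
      by_cases hgP : g ∈ P
      · exact Or.inr ⟨hgP, hgpp⟩
      · exact Or.inl ⟨hg, hgP⟩
    · rintro (⟨hg, hgP⟩ | ⟨hgP, hgpp⟩)
      · exact ⟨hg, fun h => hgP (hpair h)⟩
      · exact ⟨hPg hgP, hgpp⟩
  have hcardP' : (P \ {p, p'}).card = 1 := by
    rw [card_sdiff_of_subset hpair, hP, card_pair hpp']
  have hup : rk N (gr N \ {p, p'}) ≤ 5 := by
    rw [hsplit]
    have h1 := rk_union_le (M := N) (gr N \ P) (P \ {p, p'})
    have h2 := rk_le_card (M := N) (P \ {p, p'})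
    omega
  -- the lower bound: `E − {p, p'} = (E − p) − p'`
  have hlow : 5 ≤ rk N (gr N \ {p, p'}) := by
    have hE : gr N \ {p, p'} = ((gr N).erase p).erase p' := by
      ext g
      rw [mem_sdiff, mem_erase, mem_erase, mem_insert, mem_singleton]
      constructor
      · rintro ⟨hg, h⟩
        exact ⟨fun h' => h (Or.inr h'), fun h' => h (Or.inl h'), hg⟩
      · rintro ⟨h1, h2, hg⟩
        exact ⟨hg, fun h => h.elim h2 h1⟩
    rw [hE]
    have h1 := rk_le_rk_erase_add_one (M := N) (erase_subset p (gr N)) (mem_erase.2 ⟨hpp'.symm, hp'g⟩)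
    have h2 := hcf p hpg
    omega
  omega

/-- In a deficient demand, `ρ(W + p + p') = 6` for `p ≠ p'` in `P`: otherwise `p' ∈ cl(W + p)`, and with
`K ⊆ cl W ⊆ cl(W + p)` the set `E − p''` (`p''` the third point of `P`) would lie in a rank-`5` flat. -/
theorem rk_insert_insert_eq_six_of_deficient
    (hcf : ∀ x ∈ gr N, rk N ((gr N).erase x) = 6) {W : Finset α} (hW : W ∈ biIndepSets N 4)
    (hP : ((gr N \ W).filter (fun z => rk N (insert z W) = 5)).card = 3) {p p' : α}
    (hp : p ∈ (gr N \ W).filter (fun z => rk N (insert z W) = 5))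
    (hp' : p' ∈ (gr N \ W).filter (fun z => rk N (insert z W) = 5)) (hpp' : p ≠ p') :
    rk N (insert p' (insert p W)) = 6 := by
  rw [mem_biIndepSets] at hW
  obtain ⟨hWg, hW4, hWrk, hWc⟩ := hW
  rw [hW4] at hWrk
  set P := (gr N \ W).filter (fun z => rk N (insert z W) = 5) with hPdef
  have hPB : P ⊆ gr N \ W := filter_subset _ _
  have hPg : P ⊆ gr N := hPB.trans sdiff_subset
  have hpg : p ∈ gr N := hPg hp
  have hp'g : p' ∈ gr N := hPg hp'
  have hp5 : rk N (insert p W) = 5 := (mem_filter.1 hp).2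
  have hWp : insert p W ⊆ gr N := insert_subset hpg hWg
  by_contra hne
  have h1 := rk_insert_le_add_one hp'g hWp
  have h2 := rk_mono' (M := N) (subset_insert p' (insert p W))
  have h5 : rk N (insert p' (insert p W)) = 5 := by omega
  -- `E ∖ (P ∖ {p, p'}) ⊆ cl(W + p)`
  have hpair : ({p, p'} : Finset α) ⊆ P := by
    intro g hg
    rw [mem_insert, mem_singleton] at hg
    rcases hg with h | h <;> subst h <;> assumption
  have hcl : gr N \ (P \ {p, p'}) ⊆ clF N (insert p W) := by
    intro g hg
    rw [mem_sdiff, mem_sdiff, not_and, not_not] at hg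
    by_cases hgP : g ∈ P
    · have hgpp := hg.2 hgP
      rw [mem_insert, mem_singleton] at hgpp
      rcases hgpp with h | h
      · subst h
        exact mem_clF_of_mem_of_subset_gr hWp (mem_insert_self _ _)
      · subst h
        rw [mem_clF_iff_rk_insert_eq hp'g hWp, h5, hp5]
    · by_cases hgW : g ∈ W
      · exact mem_clF_of_mem_of_subset_gr hWp (mem_insert_of_mem hgW)
      · have hgB : g ∈ gr N \ W := mem_sdiff.2 ⟨hg.1, hgW⟩
        have h5' : rk N (insert g W) ≠ 5 := fun h => hgP (mem_filter.2 ⟨hgB, h⟩)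
        have h1' := rk_insert_le_add_one hg.1 hWg
        have h2' := rk_mono' (M := N) (subset_insert g W)
        have hgcl : g ∈ clF N W := by
          rw [mem_clF_iff_rk_insert_eq hg.1 hWg]
          omega
        exact mem_clF_of_subset (subset_insert p W) hgcl
  have hcardP' : (P \ {p, p'}).card = 1 := by
    rw [card_sdiff_of_subset hpair, hP, card_pair hpp']
  obtain ⟨x, hx⟩ := card_eq_one.1 hcardP'
  have hxg : x ∈ gr N := by
    have : x ∈ P \ {p, p'} := by rw [hx]; exact mem_singleton_self x
    exact hPg (mem_sdiff.1 this).1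
  rw [hx, sdiff_singleton_eq_erase] at hcl
  have h3 := rk_le_rk_of_subset_clF hcl
  have h4 := hcf x hxg
  omega

end InOutTenA

end PercRepro.Cogirth
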